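/-
Copyright (c) 2026 the pub-hodgecm-mathlib formalisation cell (harness21).  Prover seat hodgecm-mathlib-LH4-p10 (g0), req620 Track A «(D-RAM) FOUR-FRAME» squad
(unit U3_Laws, stubs `stub_U3_stableLaw_RP ∕ _RU`; the (S-fin) line of MEMO-stableLaw-finite (LH4-p10), bricks (a)+(b) «column-HNF ∕ T-stability»).  2026-09-03.
-/
import Summits.HodgeConjecture.HodgeConjecture.Theorems.F0P3cDyRamDiagonalModuleCriterion   -- ★ p855126 (LH4-p11): `mapGL_eq_of_mapGL_le_of_diagonal_three`; brings ★ `UnitaryLatticeTree*`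
import Literature.NumberTheory.Automorphic.UnitaryLatticeTreeStabilizer                    -- ★ `mapGL_latt_le_latt_iff` (`γ·latt g ≤ latt g' ↔ g'⁻¹γg` integral)
import HarnessLib

/-!
# Crux `H413`, line LH4 «(D-RAM) FOUR-FRAME» road — unit U3_Laws (iii), TIER 2 SUPPORT: THE T-STABILITY CRITERION FOR A COLUMN-HNF LATTICE in the diagonal model
# (the three valuation conditions that enumerate the `γ`-stable normalised lattices `𝓛₀` of the finite reformulation (S-fin) of the STABLE LAW)

Cell `hodgecm-mathlib` (D-0151), FLOOR 0, crux item H413 = `stmt-HodgeConjecture-24833`, route of record `HCCMUnconditional`; squad F0∕P3c∕LH4 (req618∕req620).  THEOREMS ONLY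
(no `def`, no instance, no notation, no `sorry`, default heartbeats); lane `--supports stmt-HodgeConjecture-24833 --as helper` (count-neutral).  Currency of ★ p855032 ∕ p855126:
the diagonal literal `T = diag(s)` with UNIT entries (`s = (α, β, 1)` for the four-frame census).

WHAT IS PROVED.  Every `𝒪`-lattice `M ⊆ K³` with `pr₁(M) = 𝒪` has a unique basis in column Hermite normal form `V = [[1,0,0],[x,ϖ^b,0],[y,z,ϖ^c]]` (`x mod 𝔭^b`, `y, z mod 𝔭^c`);
this file proves WHEN such a lattice `latt V` is `T`-stable:

  `T·latt V = latt V  ⟺  |(s₁−s₀)·x·ϖ^{−b}| ≤ 1 ∧ |(s₂−s₁)·z·ϖ^{−c}| ≤ 1 ∧ |((s₂−s₀)·y + (s₀−s₁)·x·z·ϖ^{−b})·ϖ^{−c}| ≤ 1`      (`mapGL_latt_hnf_eq_iff`),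

i.e. `v(z) ≥ c − v(s₂−s₁)`, `b ≤ v(s₁−s₀) + v(x)` and `v((s₂−s₀)y + (s₀−s₁)xzϖ^{−b}) ≥ c` — EXACTLY the three congruences by which the oracle `explore/finite_engine2.py` of
MEMO-stableLaw-finite (LH4-p10 (g0), 2026-09-03) enumerates `𝓛₀` (and found `|𝓛₀| = q^{v(s₀−s₁)+v(s₀−s₂)+v(s₁−s₂)}` and the (S-fin) identity on every run: ℚ₂(√2) ×3, e_F = 2 ×3,
q = 4 equilateral, tame).  With `s = (α, β, 1)`: `A = s₀ − s₂ = α − 1`, `B = s₁ − s₂ = β − 1`, `C = s₁ − s₀ = β − α`, the conditions read `v(Bz) ≥ c`, `v(Cx) ≥ b`, `v(Ay + Cxzϖ^{−b}) ≥ c`.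

THE MATHEMATICS ([Serre1980Trees, II §1.1]; [BruhatTits1972, §10]).  `T·latt V = latt V ⟺ T·latt V ≤ latt V` for a UNIT diagonal `T` (★ p855126 `mapGL_eq_of_mapGL_le_of_diagonal_three`,
Cayley–Hamilton), `⟺ V⁻¹·T·V` integral (★ `mapGL_latt_le_latt_iff`), and `V⁻¹ T V` is the lower-triangular matrix with diagonal `(s₀, s₁, s₂)` (units) and sub-diagonal entries
`(s₁−s₀)xϖ^{−b}`, `(s₂−s₁)zϖ^{−c}`, `((s₂−s₀)y + (s₀−s₁)xzϖ^{−b})ϖ^{−c}` (explicit inverse `V⁻¹ = [[1,0,0],[−xϖ^{−b}, ϖ^{−b}, 0],[(xzϖ^{−b} − y)ϖ^{−c}, −zϖ^{−b−c}, ϖ^{−c}]]`).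
* §1 `hnf_inv_mul`, `hnf_mul_inv` (the explicit inverse), `coe_inv_eq_of_coe_eq_hnf`, `inv_mul_diagonal_mul_hnf` (the conjugate, entry by entry).
* §2 `isIntMatrix_conj_hnf_iff` (integrality ⟺ the three conditions) and the head `mapGL_latt_hnf_eq_iff`.
HONEST LABEL.  Count-neutral (`--supports`); nothing printed is asserted; the census laws stay PROVER TARGETS; the verdict of record for (D-RAM) stays PRINT
[LanglandsShelstad1989 Thm. p. 484 ∕ Rogawski1990 Prop. 4.9.1 (a)] ∕ XL; `HC_CM` is proved only modulo the 7 printed citations (2 remaining named inputs: hLiu418 =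
`stmt-HodgeConjecture-24832`, h413 = `stmt-HodgeConjecture-24833`) until rung 0 closes.

## References
* [Serre1980Trees] J.-P. Serre, *Trees* (1980), Ch. II §1.1 (lattices `g·𝒪^N`, the stabiliser `GL_N(𝒪)`, Hermite normal form of a lattice basis).
* [BruhatTits1972] F. Bruhat, J. Tits, *Groupes réductifs sur un corps local I*, Publ. Math. IHÉS 41 (1972), §10 (lattice models; fixed points of a torus element).
* [Kottwitz1986BaseChangeUnits] R. E. Kottwitz, *Base change for unit elements of Hecke algebras*, Compositio Math. 60 (1986), §1 pp. 240–241 (orbital integrals as fixed-lattice counts).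
-/

set_option autoImplicit false

noncomputable section

namespace Summit.HodgeConjecture.HodgeConjecture.Cruxes.H413.F0P3cDyRamDiagonalHNFStability

open Matrix
open Literature.NumberTheory.Automorphic Literature.NumberTheory.Automorphic.HermitianLattice Literature.NumberTheory.Automorphic.UnitaryGroup
open Literature.NumberTheory.Automorphic.UnitaryLatticeTree
open Summit.HodgeConjecture.HodgeConjecture.Cruxes.H413.F0P3cDyRamDiagonalModuleCriterion
open scoped Valued WithZero Matrix MatrixGroups

variable {K : Type*} [Field K]

/-! ## §1  The explicit inverse of the HNF frame and the conjugate `V⁻¹ T V` -/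

/-- `W·V = 1` for `V = [[1,0,0],[x,ϖ^b,0],[y,z,ϖ^c]]` and its explicit inverse `W`. [cite: Serre1980Trees, II §1.1] -/
theorem hnf_inv_mul {ϖ : K} (hϖ : ϖ ≠ 0) (x y z : K) (b c : ℕ) :
    (!![1, 0, 0; -x * (ϖ ^ b)⁻¹, (ϖ ^ b)⁻¹, 0; (x * z * (ϖ ^ b)⁻¹ - y) * (ϖ ^ c)⁻¹, -z * (ϖ ^ b)⁻¹ * (ϖ ^ c)⁻¹, (ϖ ^ c)⁻¹] : Matrix (Fin 3) (Fin 3) K) *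
        !![1, 0, 0; x, ϖ ^ b, 0; y, z, ϖ ^ c] = 1 := by
  have hb : (ϖ ^ b : K) ≠ 0 := pow_ne_zero _ hϖ
  have hc : (ϖ ^ c : K) ≠ 0 := pow_ne_zero _ hϖ
  ext i j
  fin_cases i <;> fin_cases j <;> simp [Matrix.mul_apply, Fin.sum_univ_three] <;> field_simp <;> ring

/-- `V·W = 1`. [cite: Serre1980Trees, II §1.1] -/
theorem hnf_mul_inv {ϖ : K} (hϖ : ϖ ≠ 0) (x y z : K) (b c : ℕ) :
    (!![1, 0, 0; x, ϖ ^ b, 0; y, z, ϖ ^ c] : Matrix (Fin 3) (Fin 3) K) *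
        !![1, 0, 0; -x * (ϖ ^ b)⁻¹, (ϖ ^ b)⁻¹, 0; (x * z * (ϖ ^ b)⁻¹ - y) * (ϖ ^ c)⁻¹, -z * (ϖ ^ b)⁻¹ * (ϖ ^ c)⁻¹, (ϖ ^ c)⁻¹] = 1 := by
  have hb : (ϖ ^ b : K) ≠ 0 := pow_ne_zero _ hϖ
  have hc : (ϖ ^ c : K) ≠ 0 := pow_ne_zero _ hϖ
  ext i j
  fin_cases i <;> fin_cases j <;> simp [Matrix.mul_apply, Fin.sum_univ_three] <;> field_simp <;> ring

/-- For a `GL₃` element with the HNF matrix, the inverse has the explicit matrix `W`. [cite: Serre1980Trees, II §1.1] -/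
theorem coe_inv_eq_of_coe_eq_hnf {ϖ : K} (hϖ : ϖ ≠ 0) {x y z : K} {b c : ℕ} (V : GL (Fin 3) K)
    (hV : (V : Matrix (Fin 3) (Fin 3) K) = !![1, 0, 0; x, ϖ ^ b, 0; y, z, ϖ ^ c]) :
    ((V⁻¹ : GL (Fin 3) K) : Matrix (Fin 3) (Fin 3) K) =
      !![1, 0, 0; -x * (ϖ ^ b)⁻¹, (ϖ ^ b)⁻¹, 0; (x * z * (ϖ ^ b)⁻¹ - y) * (ϖ ^ c)⁻¹, -z * (ϖ ^ b)⁻¹ * (ϖ ^ c)⁻¹, (ϖ ^ c)⁻¹] := by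
  rw [Matrix.coe_units_inv, hV]
  exact Matrix.inv_eq_left_inv (hnf_inv_mul hϖ x y z b c)

/-- **THE CONJUGATE `V⁻¹·diag(s)·V` OF A DIAGONAL LITERAL BY THE HNF FRAME**, entry by entry: lower triangular, diagonal `(s₀, s₁, s₂)`, sub-diagonal
`(s₁−s₀)xϖ^{−b}`, `(s₂−s₁)zϖ^{−c}`, corner `((s₂−s₀)y + (s₀−s₁)xzϖ^{−b})ϖ^{−c}`. [cite: Serre1980Trees, II §1.1] [cite: BruhatTits1972, §10] -/
theorem inv_mul_diagonal_mul_hnf {ϖ : K} (hϖ : ϖ ≠ 0) (x y z : K) (b c : ℕ) (s : Fin 3 → K) :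
    (!![1, 0, 0; -x * (ϖ ^ b)⁻¹, (ϖ ^ b)⁻¹, 0; (x * z * (ϖ ^ b)⁻¹ - y) * (ϖ ^ c)⁻¹, -z * (ϖ ^ b)⁻¹ * (ϖ ^ c)⁻¹, (ϖ ^ c)⁻¹] : Matrix (Fin 3) (Fin 3) K) *
        Matrix.diagonal s * !![1, 0, 0; x, ϖ ^ b, 0; y, z, ϖ ^ c] =
      !![s 0, 0, 0;
         (s 1 - s 0) * x * (ϖ ^ b)⁻¹, s 1, 0;
         ((s 2 - s 0) * y + (s 0 - s 1) * x * z * (ϖ ^ b)⁻¹) * (ϖ ^ c)⁻¹, (s 2 - s 1) * z * (ϖ ^ c)⁻¹, s 2] := by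
  have hb : (ϖ ^ b : K) ≠ 0 := pow_ne_zero _ hϖ
  have hc : (ϖ ^ c : K) ≠ 0 := pow_ne_zero _ hϖ
  have hdiag : Matrix.diagonal s = !![s 0, 0, 0; 0, s 1, 0; 0, 0, s 2] := by
    ext i j
    fin_cases i <;> fin_cases j <;> simp
  rw [hdiag]
  ext i j
  fin_cases i <;> fin_cases j <;> simp [Matrix.mul_apply, Fin.sum_univ_three] <;> field_simp <;> ring

/-! ## §2  Integrality of the conjugate and the head -/

section Valued

variable [Valued K ℤᵐ⁰]

/-- The conjugate is integral iff its three sub-diagonal entries are (the diagonal entries are the units `s_i`, the rest is `0`). [cite: Serre1980Trees, II §1.1] -/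
theorem isIntMatrix_conj_hnf_iff {ϖ : K} (x y z : K) (b c : ℕ) {s : Fin 3 → K} (hs : ∀ i, Valued.v (s i) = 1) :
    IsIntMatrix (!![s 0, 0, 0;
         (s 1 - s 0) * x * (ϖ ^ b)⁻¹, s 1, 0;
         ((s 2 - s 0) * y + (s 0 - s 1) * x * z * (ϖ ^ b)⁻¹) * (ϖ ^ c)⁻¹, (s 2 - s 1) * z * (ϖ ^ c)⁻¹, s 2] : Matrix (Fin 3) (Fin 3) K) ↔
      Valued.v ((s 1 - s 0) * x * (ϖ ^ b)⁻¹) ≤ 1 ∧ Valued.v ((s 2 - s 1) * z * (ϖ ^ c)⁻¹) ≤ 1 ∧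
        Valued.v (((s 2 - s 0) * y + (s 0 - s 1) * x * z * (ϖ ^ b)⁻¹) * (ϖ ^ c)⁻¹) ≤ 1 := by
  constructor
  · intro h
    exact ⟨by simpa using h 1 0, by simpa using h 2 1, by simpa using h 2 0⟩
  · rintro ⟨h10, h21, h20⟩ i j
    fin_cases i <;> fin_cases j <;>
      first | (simp [hs]; done) | simpa using h10 | simpa using h21 | simpa using h20

/-- **HEAD — THE T-STABILITY CRITERION FOR A COLUMN-HNF LATTICE.**  For `ϖ ≠ 0`, a diagonal literal `T = diag(s)` with UNIT entries and a `GL₃` element `V` with matrix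
`[[1,0,0],[x,ϖ^b,0],[y,z,ϖ^c]]`:  `T·latt V = latt V ⟺ |(s₁−s₀)xϖ^{−b}| ≤ 1 ∧ |(s₂−s₁)zϖ^{−c}| ≤ 1 ∧ |((s₂−s₀)y + (s₀−s₁)xzϖ^{−b})ϖ^{−c}| ≤ 1` — the three congruences
enumerating the `T`-stable normalised lattices `𝓛₀` of (S-fin). (`≤ ⇒ =` for unit diagonals: ★ p855126; stabiliser test: ★ `mapGL_latt_le_latt_iff`.)
[cite: Serre1980Trees, II §1.1] [cite: BruhatTits1972, §10] [cite: Kottwitz1986BaseChangeUnits, §1 pp. 240–241] -/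
theorem mapGL_latt_hnf_eq_iff {ϖ : K} (hϖ : ϖ ≠ 0) (s : Fin 3 → K) (hs : ∀ i, Valued.v (s i) = 1) (T : GL (Fin 3) K)
    (hT : (T : Matrix (Fin 3) (Fin 3) K) = Matrix.diagonal s) {x y z : K} {b c : ℕ} (V : GL (Fin 3) K)
    (hV : (V : Matrix (Fin 3) (Fin 3) K) = !![1, 0, 0; x, ϖ ^ b, 0; y, z, ϖ ^ c]) :
    mapGL T (latt (V : Matrix (Fin 3) (Fin 3) K)) = latt (V : Matrix (Fin 3) (Fin 3) K) ↔
      Valued.v ((s 1 - s 0) * x * (ϖ ^ b)⁻¹) ≤ 1 ∧ Valued.v ((s 2 - s 1) * z * (ϖ ^ c)⁻¹) ≤ 1 ∧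
        Valued.v (((s 2 - s 0) * y + (s 0 - s 1) * x * z * (ϖ ^ b)⁻¹) * (ϖ ^ c)⁻¹) ≤ 1 := by
  rw [← isIntMatrix_conj_hnf_iff x y z b c hs, ← inv_mul_diagonal_mul_hnf hϖ x y z b c s, ← hV, ← hT, ← coe_inv_eq_of_coe_eq_hnf hϖ V hV,
    ← Units.val_mul, ← Units.val_mul, ← mapGL_latt_le_latt_iff T V V]
  exact ⟨fun h => h.le, fun h => mapGL_eq_of_mapGL_le_of_diagonal_three s hs T hT _ h⟩

end Valued

end Summit.HodgeConjecture.HodgeConjecture.Cruxes.H413.F0P3cDyRamDiagonalHNFStability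

end
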